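import Summits.CriticalPhenomena.PercolationContinuityZ3.Theorems.PercNearOneGluingNoHeavyQuantIndepBlobGapRow
import HarnessLib

/-!
# QUANT lane R8, FAR on trees: the TWO-LEVEL ROW for independent blobs with gates `≥ 1/2`
# (`EW > 2y + 1 ⟹ P(W ≥ y + 2) + P(W ≥ y) ≥ 2 · g_min`)

builds on p205010 (kernel theorem, internal audit signed; external expert review pending)

Support file (`--supports stmt-CriticalPhenomena-4575`), QUANT lane seat prim-quant-census-1 (gen 11); memo
`run/shared/lean/prim/quant/prim-quant-census-1/B4-SLIVER-G11.md` §2–§4.  Theorems only; no sorries; standard axioms.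

**Why.**  The last open piece (B-4) of census-1 gen 10's proof of the profile conjecture `Quant.HubBlocksProfileIneq` (memo
PROFILE-PROOF-G10 §11) is the two-point-hub inequality TP1 (census-2 gen 46, TP-REDUCTION-SURPLUS-FAR R1) in the SLIVER regime where the
block sum `W = Σ a_x ζ_x` is less than one unit short of block-star FAR at the relevant level (`EW > 2y − 3`).  There TP1 follows from two
blob-sum statements one half-level above FAR (memo B4-SLIVER-G11 §2): the two-level row `P(W ≥ y) + P(W ≥ y−2) ≥ 2g` (enough when the hub
weight `λ ≥ 1/2`) and a sharp half-row (when `λ < 1/2`).  This file proves the two-level row when every gate is `≥ 1/2`, by conditioning on the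
least reliable blob and two applications of p1 gen 7's two-threshold transport row `Quant.IndepBlob.gapRow_of_half_le_gate`.

* `Quant.IndepBlob.tail_split` — conditioning identity on one blob `x₀`:
  `P(t ≤ W) = p x₀ · P'(t ≤ a x₀ + W') + (1 − p x₀) · P'(t ≤ W')`, `W'` the other blobs (sums of product weights over the subtype `{k // k ≠ x₀}`).
* `Quant.IndepBlob.twoLevelRow_of_half_le_gate` — gates `p y₀ ≤ p k ≤ 1` with `1/2 ≤ p y₀`, integer sizes `a k ≥ 1`, a level `y : ℕ`:
  if `2y + 1 < Σ a k p k` then `2 · p y₀ ≤ P(y + 2 ≤ W) + P(y ≤ W)`.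
  (Levels written `y + 2`, `y` to avoid truncated subtraction; in the memo's notation this is `EW > 2Y − 3 ⟹ π(Y) + π(Y−2) ≥ 2g`, `Y = y + 2`.)
  Proof: with `g = p y₀`, `a₀ = a y₀` and `A₁ = P'(y+2 ≤ a₀ + W')`, `A₂ = P'(y ≤ a₀ + W')`, `B₁ = P'(y+2 ≤ W')`, `B₂ = P'(y ≤ W')` the claim is
  `g(A₁ + A₂) + (1−g)(B₁ + B₂) ≥ 2g`, i.e. `g(1 − A₁) + g(1 − A₂) ≤ (1−g)(B₁ + B₂)`.  Since `Σ_k a k ≥ 2y + 2`, the other blobs have total size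
  `≥ 2y + 2 − a₀`, so the gap row gives `g·P'(W' < y − a₀) ≤ (1−g)·P'(W' ≥ y + 2)` and, if `a₀ ≥ 2`, `g·P'(W' < y + 2 − a₀) ≤ (1−g)·P'(W' ≥ y)`;
  if `a₀ = 1` the second row is `g·P'(W' ≤ y) ≤ g(1−g) ≤ (1−g)·P'(W' ≥ y)` by block-star FAR for `W'` at `j = y` (twice); if `a₀ ≥ y + 2` then
  `A₁ = A₂ = 1` and there is nothing to do.  Sharp: two blobs of size `y + 1` with equal gates give equality.
[this work]
-/

namespace Summit.CriticalPhenomena.PercolationContinuityZ3.Theorems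

namespace Quant

namespace IndepBlob

open Finset

variable {κ : Type*} [Fintype κ] [DecidableEq κ]

/-- **Conditioning a tail event on one blob.**  For gates `p`, sizes `a : κ → ℕ`, a blob `x₀` and a level `t : ℕ`:
`Σ_{s : t ≤ a(s)} w(s) = p x₀ · Σ_{W : t ≤ a x₀ + a(W)} w'(W) + (1 − p x₀) · Σ_{W : t ≤ a(W)} w'(W)`, the sums on the right over the finsets of the
subtype `{k // k ≠ x₀}` with its product weight `w'`. [folklore] -/
theorem tail_split (p : κ → ℝ) (a : κ → ℕ) (x₀ : κ) (t : ℕ) :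
    ∑ s ∈ (Finset.univ : Finset (Finset κ)).filter (fun s => t ≤ ∑ k ∈ s, a k), (∏ k, if k ∈ s then p k else 1 - p k) =
      p x₀ * ∑ W ∈ (Finset.univ : Finset (Finset {k : κ // k ≠ x₀})).filter
          (fun W : Finset {k : κ // k ≠ x₀} => t ≤ a x₀ + ∑ i ∈ W, a (i : κ)),
            (∏ i : {k : κ // k ≠ x₀}, if i ∈ W then p i else 1 - p i) +
        (1 - p x₀) * ∑ W ∈ (Finset.univ : Finset (Finset {k : κ // k ≠ x₀})).filter
          (fun W : Finset {k : κ // k ≠ x₀} => t ≤ ∑ i ∈ W, a (i : κ)),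
            (∏ i : {k : κ // k ≠ x₀}, if i ∈ W then p i else 1 - p i) := by
  set ι := {k : κ // k ≠ x₀} with hι
  set emb : ι ↪ κ := Function.Embedding.subtype _ with hemb
  set G : Finset κ → ℝ := fun s =>
    if t ≤ ∑ k ∈ s, a k then (∏ k, if k ∈ s then p k else 1 - p k) else 0 with hG
  have hLHS : ∑ s ∈ (Finset.univ : Finset (Finset κ)).filter (fun s => t ≤ ∑ k ∈ s, a k),
      (∏ k, if k ∈ s then p k else 1 - p k) = ∑ s : Finset κ, G s := by
    rw [hG, Finset.sum_filter]
  have hsplit : ∑ s : Finset κ, G s =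
      ∑ W : Finset ι, G (W.map emb) + ∑ W : Finset ι, G (insert x₀ (W.map emb)) := by
    rw [← Finset.powerset_univ, ← Finset.insert_erase (Finset.mem_univ x₀),
      Finset.sum_powerset_insert (Finset.notMem_erase x₀ _), sum_powerset_erase_eq_sum_subtype,
      sum_powerset_erase_eq_sum_subtype]
  have hnot : ∀ W : Finset ι, x₀ ∉ W.map emb := by
    intro W hW
    rw [Finset.mem_map] at hW
    obtain ⟨i, -, hi⟩ := hW
    exact i.2 hi
  have h1 : ∑ W : Finset ι, G (insert x₀ (W.map emb)) =
      p x₀ * ∑ W ∈ (Finset.univ : Finset (Finset ι)).filter (fun W : Finset ι => t ≤ a x₀ + ∑ i ∈ W, a (i : κ)),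
        (∏ i : ι, if i ∈ W then p i else 1 - p i) := by
    rw [Finset.sum_filter, Finset.mul_sum]
    refine Finset.sum_congr rfl fun W _ => ?_
    have hX : ∑ k ∈ insert x₀ (W.map emb), a k = a x₀ + ∑ i ∈ W, a (i : κ) := by
      rw [Finset.sum_insert (hnot W), Finset.sum_map]
      rfl
    simp only [hG, hX]
    split_ifs
    · rw [hemb, prod_ite_mem_insert_map_subtype]
    · rw [mul_zero]
  have h0 : ∑ W : Finset ι, G (W.map emb) =
      (1 - p x₀) * ∑ W ∈ (Finset.univ : Finset (Finset ι)).filter (fun W : Finset ι => t ≤ ∑ i ∈ W, a (i : κ)),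
        (∏ i : ι, if i ∈ W then p i else 1 - p i) := by
    rw [Finset.sum_filter, Finset.mul_sum]
    refine Finset.sum_congr rfl fun W _ => ?_
    have hX : ∑ k ∈ W.map emb, a k = ∑ i ∈ W, a (i : κ) := by
      rw [Finset.sum_map]
      rfl
    simp only [hG, hX]
    split_ifs
    · rw [hemb, prod_ite_mem_map_subtype]
    · rw [mul_zero]
  rw [hLHS, hsplit, h1, h0]
  ring

/-- **Two-level row, all gates `≥ 1/2`.**  For gates `0 ≤ p k ≤ 1` with a least reliable blob `y₀` (`p y₀ ≤ p k`) satisfying `1/2 ≤ p y₀`,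
integer sizes `a k ≥ 1`, and a level `y : ℕ` with `2y + 1 < EW = Σ a k · p k`:
`2 · p y₀ ≤ P(W ≥ y + 2) + P(W ≥ y)`, i.e. `Σ_{s : y+2 ≤ a(s)} w(s) + Σ_{s : y ≤ a(s)} w(s) ≥ 2 p y₀`.
Block-star FAR (`far_indepBlob_min`) is `EW > 2(y+1) ⟹ P(W ≥ y + 2) ≥ p y₀`; here the mean may be one unit smaller and the missing mass at
level `y + 2` is found two levels down.  Equality for two blobs of size `y + 1` with equal gates. [this work] -/
theorem twoLevelRow_of_half_le_gate (p : κ → ℝ) (a : κ → ℕ) (hp0 : ∀ k, 0 ≤ p k) (hp1 : ∀ k, p k ≤ 1)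
    (ha : ∀ k, 1 ≤ a k) (y₀ : κ) (hy₀ : ∀ k, p y₀ ≤ p k) (hhalf : 1 / 2 ≤ p y₀) (y : ℕ)
    (h : 2 * (y : ℝ) + 1 < ∑ k, (a k : ℝ) * p k) :
    2 * p y₀ ≤
      ∑ s ∈ (Finset.univ : Finset (Finset κ)).filter (fun s => y + 2 ≤ ∑ k ∈ s, a k), (∏ k, if k ∈ s then p k else 1 - p k) +
        ∑ s ∈ (Finset.univ : Finset (Finset κ)).filter (fun s => y ≤ ∑ k ∈ s, a k), (∏ k, if k ∈ s then p k else 1 - p k) := by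
  set ι := {k : κ // k ≠ y₀} with hι
  set g : ℝ := p y₀ with hg
  have hg1 : g ≤ 1 := hp1 y₀
  have hg0 : 0 ≤ g := hp0 y₀
  have hw0' : ∀ W : Finset ι, 0 ≤ (∏ i : ι, if i ∈ W then p i else 1 - p i) :=
    bernoulliWeight_nonneg (fun i => hp0 i) (fun i => hp1 i)
  -- notation for the four conditional probabilities
  set A1 : ℝ := ∑ W ∈ (Finset.univ : Finset (Finset ι)).filter (fun W : Finset ι => y + 2 ≤ a y₀ + ∑ i ∈ W, a (i : κ)),
      (∏ i : ι, if i ∈ W then p i else 1 - p i) with hA1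
  set A2 : ℝ := ∑ W ∈ (Finset.univ : Finset (Finset ι)).filter (fun W : Finset ι => y ≤ a y₀ + ∑ i ∈ W, a (i : κ)),
      (∏ i : ι, if i ∈ W then p i else 1 - p i) with hA2
  set B1 : ℝ := ∑ W ∈ (Finset.univ : Finset (Finset ι)).filter (fun W : Finset ι => y + 2 ≤ ∑ i ∈ W, a (i : κ)),
      (∏ i : ι, if i ∈ W then p i else 1 - p i) with hB1
  set B2 : ℝ := ∑ W ∈ (Finset.univ : Finset (Finset ι)).filter (fun W : Finset ι => y ≤ ∑ i ∈ W, a (i : κ)),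
      (∏ i : ι, if i ∈ W then p i else 1 - p i) with hB2
  rw [tail_split p a y₀ (y + 2), tail_split p a y₀ y]
  show 2 * g ≤ g * A1 + (1 - g) * B1 + (g * A2 + (1 - g) * B2)
  have hB1nn : 0 ≤ B1 := Finset.sum_nonneg fun W _ => hw0' W
  have hB2nn : 0 ≤ B2 := Finset.sum_nonneg fun W _ => hw0' W
  -- complements of `A1`, `A2` as strict lower tails of `W'` with real thresholds
  have htot := sum_bernoulliWeight (fun i : ι => p i)
  have hcA1 : 1 - A1 = ∑ W ∈ (Finset.univ : Finset (Finset ι)).filter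
      (fun W : Finset ι => ∑ i ∈ W, ((a (i : κ) : ℕ) : ℝ) < (y : ℝ) + 2 - a y₀), (∏ i : ι, if i ∈ W then p i else 1 - p i) := by
    have hc := Finset.sum_filter_add_sum_filter_not (Finset.univ : Finset (Finset ι))
      (fun W : Finset ι => y + 2 ≤ a y₀ + ∑ i ∈ W, a (i : κ)) (fun W : Finset ι => (∏ i : ι, if i ∈ W then p i else 1 - p i))
    rw [htot] at hc
    have he : (Finset.univ : Finset (Finset ι)).filter (fun W : Finset ι => ¬ (y + 2 ≤ a y₀ + ∑ i ∈ W, a (i : κ))) =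
        (Finset.univ : Finset (Finset ι)).filter (fun W : Finset ι => ∑ i ∈ W, ((a (i : κ) : ℕ) : ℝ) < (y : ℝ) + 2 - a y₀) := by
      refine Finset.filter_congr fun W _ => ?_
      rw [not_le]
      constructor
      · intro hlt
        have : ((a y₀ + ∑ i ∈ W, a (i : κ) : ℕ) : ℝ) < ((y + 2 : ℕ) : ℝ) := by exact_mod_cast hlt
        push_cast at this
        linarith
      · intro hlt
        have : ((a y₀ : ℝ) + ∑ i ∈ W, ((a (i : κ) : ℕ) : ℝ)) < (y : ℝ) + 2 := by linarith
        exact_mod_cast this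
    rw [← he]
    linarith
  have hcA2 : 1 - A2 = ∑ W ∈ (Finset.univ : Finset (Finset ι)).filter
      (fun W : Finset ι => ∑ i ∈ W, ((a (i : κ) : ℕ) : ℝ) < (y : ℝ) - a y₀), (∏ i : ι, if i ∈ W then p i else 1 - p i) := by
    have hc := Finset.sum_filter_add_sum_filter_not (Finset.univ : Finset (Finset ι))
      (fun W : Finset ι => y ≤ a y₀ + ∑ i ∈ W, a (i : κ)) (fun W : Finset ι => (∏ i : ι, if i ∈ W then p i else 1 - p i))
    rw [htot] at hc
    have he : (Finset.univ : Finset (Finset ι)).filter (fun W : Finset ι => ¬ (y ≤ a y₀ + ∑ i ∈ W, a (i : κ))) =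
        (Finset.univ : Finset (Finset ι)).filter (fun W : Finset ι => ∑ i ∈ W, ((a (i : κ) : ℕ) : ℝ) < (y : ℝ) - a y₀) := by
      refine Finset.filter_congr fun W _ => ?_
      rw [not_le]
      constructor
      · intro hlt
        have : ((a y₀ + ∑ i ∈ W, a (i : κ) : ℕ) : ℝ) < ((y : ℕ) : ℝ) := by exact_mod_cast hlt
        push_cast at this
        linarith
      · intro hlt
        have : ((a y₀ : ℝ) + ∑ i ∈ W, ((a (i : κ) : ℕ) : ℝ)) < (y : ℝ) := by linarith
        exact_mod_cast this
    rw [← he]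
    linarith
  -- `B1`, `B2` with real thresholds
  have hrB1 : B1 = ∑ W ∈ (Finset.univ : Finset (Finset ι)).filter
      (fun W : Finset ι => (y : ℝ) + 2 ≤ ∑ i ∈ W, ((a (i : κ) : ℕ) : ℝ)), (∏ i : ι, if i ∈ W then p i else 1 - p i) := by
    rw [hB1]
    refine Finset.sum_congr (Finset.filter_congr fun W _ => ?_) fun _ _ => rfl
    constructor
    · intro hle
      have : ((y + 2 : ℕ) : ℝ) ≤ ((∑ i ∈ W, a (i : κ) : ℕ) : ℝ) := by exact_mod_cast hle
      push_cast at this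
      linarith
    · intro hle
      have : (y : ℝ) + 2 ≤ ∑ i ∈ W, ((a (i : κ) : ℕ) : ℝ) := hle
      exact_mod_cast this
  have hrB2 : B2 = ∑ W ∈ (Finset.univ : Finset (Finset ι)).filter
      (fun W : Finset ι => (y : ℝ) ≤ ∑ i ∈ W, ((a (i : κ) : ℕ) : ℝ)), (∏ i : ι, if i ∈ W then p i else 1 - p i) := by
    rw [hB2]
    refine Finset.sum_congr (Finset.filter_congr fun W _ => ?_) fun _ _ => rfl
    constructor
    · intro hle
      have : ((y : ℕ) : ℝ) ≤ ((∑ i ∈ W, a (i : κ) : ℕ) : ℝ) := by exact_mod_cast hle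
      push_cast at this
      linarith
    · intro hle
      have : (y : ℝ) ≤ ∑ i ∈ W, ((a (i : κ) : ℕ) : ℝ) := hle
      exact_mod_cast this
  -- Case `a y₀ ≥ y + 2`: the blob `y₀` alone reaches both levels
  by_cases hbig : y + 2 ≤ a y₀
  · have hA1one : A1 = 1 := by
      have hf : (Finset.univ : Finset (Finset ι)).filter (fun W : Finset ι => y + 2 ≤ a y₀ + ∑ i ∈ W, a (i : κ)) = Finset.univ :=
        Finset.filter_true_of_mem fun W _ => by omega
      rw [hA1, hf]
      exact htot
    have hA2one : A2 = 1 := by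
      have hf : (Finset.univ : Finset (Finset ι)).filter (fun W : Finset ι => y ≤ a y₀ + ∑ i ∈ W, a (i : κ)) = Finset.univ :=
        Finset.filter_true_of_mem fun W _ => by omega
      rw [hA2, hf]
      exact htot
    rw [hA1one, hA2one]
    nlinarith
  push Not at hbig
  -- total size of the other blobs
  have hsumall : ∑ k, (a k : ℝ) * p k = (a y₀ : ℝ) * p y₀ + ∑ i : ι, ((a (i : κ) : ℕ) : ℝ) * p i := by
    rw [← Finset.add_sum_erase Finset.univ _ (Finset.mem_univ y₀),
      Finset.sum_subtype (Finset.univ.erase y₀) (p := fun k => k ≠ y₀) (fun k => by simp)]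
  have hsize : 2 * (y : ℝ) + 2 - a y₀ ≤ ∑ i : ι, ((a (i : κ) : ℕ) : ℝ) := by
    -- `Σ_κ a ≥ 2y + 2` as an integer inequality, then split at `y₀`
    have hle1 : ∑ k, (a k : ℝ) * p k ≤ ∑ k, (a k : ℝ) := by
      refine Finset.sum_le_sum fun k _ => ?_
      have := hp1 k
      have : (0 : ℝ) ≤ a k := by positivity
      nlinarith
    have hnat : 2 * y + 1 < ∑ k, a k := by
      have : (2 * (y : ℝ) + 1) < ((∑ k, a k : ℕ) : ℝ) := by push_cast; linarith
      exact_mod_cast this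
    have hnat2 : 2 * y + 2 ≤ ∑ k, a k := by omega
    have hsplit : ∑ k, a k = a y₀ + ∑ i : ι, a (i : κ) := by
      rw [← Finset.add_sum_erase Finset.univ _ (Finset.mem_univ y₀),
        Finset.sum_subtype (Finset.univ.erase y₀) (p := fun k => k ≠ y₀) (fun k => by simp)]
    rw [hsplit] at hnat2
    have : ((2 * y + 2 : ℕ) : ℝ) ≤ ((a y₀ + ∑ i : ι, a (i : κ) : ℕ) : ℝ) := by exact_mod_cast hnat2
    push_cast at this
    linarith
  -- Row 1: `g · (1 − A2) ≤ (1 − g) · B1`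
  have hrow1 : g * (1 - A2) ≤ (1 - g) * B1 := by
    have := gapRow_of_half_le_gate (fun i : ι => p i) (fun i : ι => ((a (i : κ) : ℕ) : ℝ)) g hhalf hg1
      (fun i => hy₀ i) (fun i => hp1 i) (fun i => by positivity) ((y : ℝ) - a y₀) ((y : ℝ) + 2)
      (by linarith [(Nat.cast_nonneg (a y₀) : (0 : ℝ) ≤ a y₀)]) (by linarith)
    rw [hcA2, hrB1]
    exact this
  -- Row 2: `g · (1 − A1) ≤ (1 − g) · B2`
  have hrow2 : g * (1 - A1) ≤ (1 - g) * B2 := by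
    by_cases ha1 : a y₀ = 1
    · -- `a y₀ = 1`: block-star FAR for the other blobs at `j = y`
      have hιne : Nonempty ι := by
        by_contra hιe
        rw [not_nonempty_iff] at hιe
        have hs0 : ∑ i : ι, ((a (i : κ) : ℕ) : ℝ) * p i = 0 := by
          rw [Finset.univ_eq_empty, Finset.sum_empty]
        rw [hsumall, hs0, ha1] at h
        push_cast at h
        have : (0 : ℝ) ≤ y := Nat.cast_nonneg y
        linarith
      obtain ⟨y', -, hy'⟩ := Finset.exists_min_image Finset.univ (fun i : ι => p i) Finset.univ_nonempty
      have hjm : 2 * (y : ℝ) < ∑ i : ι, ((a (i : κ) : ℕ) : ℝ) * p i := by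
        rw [hsumall, ha1] at h
        push_cast at h
        linarith
      have hfar := far_indepBlob_min (fun i : ι => p i) (fun i : ι => ((a (i : κ) : ℕ) : ℝ)) (fun i => hp0 i) (fun i => hp1 i)
        (fun i => by positivity) y' (fun i => hy' i (Finset.mem_univ i)) (y : ℝ) hjm
      -- `1 − A1 = P'(W' ≤ y)` (since `a y₀ = 1`)
      have hcA1' : 1 - A1 = ∑ W ∈ (Finset.univ : Finset (Finset ι)).filter
          (fun W : Finset ι => ∑ i ∈ W, ((a (i : κ) : ℕ) : ℝ) ≤ (y : ℝ)), (∏ i : ι, if i ∈ W then p i else 1 - p i) := by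
        rw [hcA1]
        refine Finset.sum_congr (Finset.filter_congr fun W _ => ?_) fun _ _ => rfl
        rw [ha1]
        push_cast
        constructor
        · intro hlt
          have h2 : ((∑ i ∈ W, a (i : κ) : ℕ) : ℝ) < (y : ℝ) + 1 := by push_cast; linarith
          have h3 : (∑ i ∈ W, a (i : κ)) < y + 1 := by exact_mod_cast h2
          have h4 : (∑ i ∈ W, a (i : κ)) ≤ y := by omega
          have h5 : ((∑ i ∈ W, a (i : κ) : ℕ) : ℝ) ≤ (y : ℝ) := by exact_mod_cast h4
          push_cast at h5
          exact h5
        · intro hle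
          linarith
      -- `B2 ≥ P'(W' ≥ y + 1) = 1 − P'(W' ≤ y) ≥ g`
      have hB2ge : 1 - (1 - A1) ≤ B2 := by
        have hc := Finset.sum_filter_add_sum_filter_not (Finset.univ : Finset (Finset ι))
          (fun W : Finset ι => ∑ i ∈ W, ((a (i : κ) : ℕ) : ℝ) ≤ (y : ℝ)) (fun W : Finset ι => (∏ i : ι, if i ∈ W then p i else 1 - p i))
        rw [htot] at hc
        have hsub : ∑ W ∈ (Finset.univ : Finset (Finset ι)).filter
            (fun W : Finset ι => ¬ (∑ i ∈ W, ((a (i : κ) : ℕ) : ℝ) ≤ (y : ℝ))), (∏ i : ι, if i ∈ W then p i else 1 - p i) ≤ B2 := by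
          rw [hrB2]
          refine Finset.sum_le_sum_of_subset_of_nonneg (fun W hW => ?_) fun W _ _ => hw0' W
          rw [Finset.mem_filter] at hW ⊢
          exact ⟨hW.1, by linarith [not_le.1 hW.2]⟩
        rw [hcA1']
        linarith
      have hyy : g ≤ p y' := hy₀ y'
      have h1A1 : 1 - A1 ≤ 1 - g := by rw [hcA1']; linarith
      have hgB2 : g ≤ B2 := by linarith
      nlinarith
    · -- `a y₀ ≥ 2`: second gap row
      have ha2 : 2 ≤ a y₀ := by have := ha y₀; omega
      have := gapRow_of_half_le_gate (fun i : ι => p i) (fun i : ι => ((a (i : κ) : ℕ) : ℝ)) g hhalf hg1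
        (fun i => hy₀ i) (fun i => hp1 i) (fun i => by positivity) ((y : ℝ) + 2 - a y₀) (y : ℝ)
        (by
          have : (2 : ℝ) ≤ a y₀ := by exact_mod_cast ha2
          linarith) (by linarith)
      rw [hcA1, hrB2]
      exact this
  nlinarith
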